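import Literature.NumberTheory.Automorphic.UnitaryGroupSingularTermValue
import HarnessLib

/-!
# The value of the singular term of `U(J₃)` with ONE constant for all classes
(Rogawski, *Automorphic Representations of Unitary Groups in Three Variables* (1990), §7.2 Prop. 7.2.2, pp. 94–95.)

Topic `NumberTheory/Automorphic`; namespace `Literature.NumberTheory.Automorphic.UnitaryGroup`. THEOREMS ONLY over
accepted tree modules: no definition, no named fact, no instance, no notation, no `sorry`. Brick (U2/U3) of row (L5-iii-c)
of the T1-qs LAW 5 road (`Cruxes/H413/Lines/F0_T1InnerFormTraceIdentity.lean`): the uniform edition of ★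
`exists_integral_weight_smul_singularBracket_eq` (`UnitaryGroupSingularTermValue`) — the Haar-normalisation constant `C` is
produced BEFORE the class data `(a, b, γ₀)`, the test function `f`, the covering weights `β`, `w_T`, the idele class
domain and `T`: the (F1) constant is pinned by its clause (L0) (`∫_G Ψ = C₁ ∫_B ∫_K Ψ(bk)`, tested on a positive compact),
the (G-c) constant does not see the class, and the (C-P) push constant comes first by ★
`exists_pushConst_forall_singularTorusStage_eq_linear` (ED. 2 of `UnitaryGroupSingularTorusPush`).

* `exists_const_forall_integral_weight_smul_singularBracket_eq` — `∃ C > 0, ∀ class f β w_T 𝓕_F T, ∫_G β • b_T[f] dν_G = C · V₀ · BIG_T(f♭)`.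
* `exists_const_forall_integral_weight_smul_singularBracket_eq_mul_log_add` — the same as
  `(C · 𝔄₀(f♭)) · log T + C · 𝔅₀(f♭)` with BOTH `𝔄₀ = V₀ · ½ · V_F · μ_A(D_F)⁻¹ · 𝔉f♭(0)` and `𝔅₀` SPELLED (the
  (σ-ii) finset closer's `a k`, `b k` as functions of the key times one global scalar).

## References
* J. D. Rogawski, *Automorphic Representations of Unitary Groups in Three Variables*, Ann. of Math. Stud. 123 (1990),
  §7.2 Prop. 7.2.2 [Rogawski1990].
* J. Arthur, *The trace formula in invariant form*, Ann. of Math. 114 (1981), §2 [Arthur1981TraceFormulaInvariantForm].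
-/

set_option autoImplicit false

noncomputable section

open MeasureTheory MeasureTheory.Measure NumberField IsDedekindDomain Set Literature.MeasureTheory.Group
open scoped ENNReal NNReal MatrixGroups
open Literature.NumberTheory.Automorphic.Meyer

namespace Literature.NumberTheory.Automorphic

namespace UnitaryGroup

variable {F E : Type} [Field F] [NumberField F] [Field E] [NumberField E] [Algebra F E]
  {c : E ≃ₐ[F] E}

variable [LocallyCompactSpace (AdeleRing (𝓞 E) E)] [LocallyCompactSpace (AdeleRing (𝓞 F) F)]
  [MeasurableSpace (AdeleRing (𝓞 E) E)] [BorelSpace (AdeleRing (𝓞 E) E)]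
  [MeasurableSpace (AdeleRing (𝓞 F) F)] [BorelSpace (AdeleRing (𝓞 F) F)]
  [MeasurableSpace (quasiSplit F E c 3).Adelic] [BorelSpace (quasiSplit F E c 3).Adelic]
  [MeasurableSpace (GaloisRepresentations.ideleGroup F)] [BorelSpace (GaloisRepresentations.ideleGroup F)]
  [Algebra.IsQuadraticExtension F E]

set_option maxHeartbeats 800000 in
/-- **THE VALUE OF THE SINGULAR TERM, ONE CONSTANT FOR ALL CLASSES** (uniform edition of ★
`exists_integral_weight_smul_singularBracket_eq`): there is `C > 0` — depending only on the Haar measures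
`ν_G, μ_B, μ_T, μ_K, μ_X, μ_A, ν_F`, on `(δ, θ₀)` and on the Iwasawa decomposition — such that for EVERY singular base point
`γ₀ = ι(d(a,b,a))`, every test function `f`, all covering weights `β`, `w_T`, every idele class domain and every `T > 0`,
`∫_G β(g) • b_T[f](g) dν_G = C · (V₀ · BIG_T(f♭))`. [cite: Rogawski1990, §7.2 Prop. 7.2.2 (pp. 94–95)]
[cite: Arthur1981TraceFormulaInvariantForm, §2] -/
theorem exists_const_forall_integral_weight_smul_singularBracket_eq (hc : c * c = 1) (hc1 : c ≠ 1)
    {δ : E} (hcδ : c δ = -δ) (hδ : δ ≠ 0) (θ₀ : 𝓞 F) (hθ : θ₀ ≠ 0) (hd : δ * δ = algebraMap F E (θ₀ : F))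
    (hsq : ¬ IsSquare ((θ₀ : 𝓞 F) : F))
    (hBK : ∀ g : (quasiSplit F E c 3).Adelic, ∃ b ∈ borelAdelic F E c 3, ∃ k : (quasiSplit F E c 3).Adelic,
      adelicVal F E c 3 ((StdForm.antidiagonal 3).over E) k ∈ standardMaximalCompactGL 3 E ∧ g = b * k)
    (νG : Measure (quasiSplit F E c 3).Adelic) [νG.IsHaarMeasure]
    (μB : Measure (borelAdelic F E c 3)) [μB.IsHaarMeasure]
    (μT : Measure (torusInBorel F E c 3)) [μT.IsHaarMeasure]
    (μK : Measure ↥((standardMaximalCompactGL 3 E).comap (adelicVal F E c 3 ((StdForm.antidiagonal 3).over E)) : Subgroup (quasiSplit F E c 3).Adelic)) [μK.IsHaarMeasure]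
    (μX : Measure (AdeleRing (𝓞 E) E)) [μX.IsAddHaarMeasure] [μX.Regular]
    (μA : Measure (AdeleRing (𝓞 F) F)) [μA.IsAddHaarMeasure] [μA.Regular]
    (νF : Measure (GaloisRepresentations.ideleGroup F)) [νF.IsHaarMeasure] :
    ∃ C : ℝ, 0 < C ∧ ∀ {a b : Eˣ} (hab : (a : E) ≠ (b : E)) {g₀ : (quasiSplit F E c 3).Rational} {γ₀ : (quasiSplit F E c 3).arithmeticSubgroup}
      (hg₀ : ((g₀.val : GL (Fin 3) E) : Matrix (Fin 3) (Fin 3) E) = !![(a : E), 0, 0; 0, b, 0; 0, 0, a])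
      (hγ₀ : (γ₀ : (quasiSplit F E c 3).Adelic) = (quasiSplit F E c 3).toAdelic g₀)
      {f : (quasiSplit F E c 3).Adelic → ℂ} (hf : IsQuasiSplitTest F E c 3 f)
      {β : (quasiSplit F E c 3).Adelic → ℝ≥0∞}
      (hβ : IsCoveringWeight ((arithmeticBorel F E c 3 ⊓
        Subgroup.centralizer ({γ₀} : Set (quasiSplit F E c 3).arithmeticSubgroup)).map (quasiSplit F E c 3).arithmeticSubgroup.subtype) β)
      {wT : torusInBorel F E c 3 → ℝ≥0∞}
      (hwT : IsCoveringWeight ((rationalBorel F E c 3).subgroupOf (torusInBorel F E c 3)) wT)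
      {𝓕F : Set (GaloisRepresentations.ideleGroup F)} (h𝓕 : IsIdeleClassDomain F 𝓕F)
      (T : ℝ≥0), 0 < (T : ℝ) →
      ∫ g, (β g).toReal • ((∑' n : {n : ↥((adelicUnipotent F E c 3).subgroupOf (quasiSplit F E c 3).arithmeticSubgroup ⊓
            Subgroup.centralizer ({γ₀} : Set (quasiSplit F E c 3).arithmeticSubgroup)) // n ≠ 1},
          f ((g)⁻¹ * (((n.1 : (quasiSplit F E c 3).arithmeticSubgroup) * γ₀ : (quasiSplit F E c 3).arithmeticSubgroup) : (quasiSplit F E c 3).Adelic) * (g))) -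
        Set.indicator {z : (quasiSplit F E c 3).Adelic | T < borelHeight z}
          (fun z => ((μA.map (traceZeroLine F E c hcδ hδ)) (traceZeroFundamentalDomain F E c)).toReal⁻¹ • ∫ w : traceZeroAdele F E c,
            f (z⁻¹ * ((γ₀ : (quasiSplit F E c 3).Adelic) * (((heisElt hc 0 w : unipotentInBorel F E c 3) : borelAdelic F E c 3) : (quasiSplit F E c 3).Adelic)) * z) ∂(μA.map (traceZeroLine F E c hcδ hδ))) (g)) ∂νG =
        (C : ℂ) * (((((μA.map (traceZeroLine F E c hcδ hδ)).real (traceZeroFundamentalDomain F E c) : ℝ) : ℂ)) *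
          ((1 / 2 : ℂ) * ((((idelicCovolume F νF).toReal * Real.log ((T : ℝ) / ((borelHeight (1 : (quasiSplit F E c 3).Adelic) : ℝ≥0) : ℝ)) : ℝ) : ℂ) *
                (((μA (adeleFundamentalDomain F)).toReal⁻¹ : ℂ) * adeleFourier F μA (fun s : AdeleRing (𝓞 F) F =>
      ∫ x : AdeleRing (𝓞 E) E, (∫ k : ↥((standardMaximalCompactGL 3 E).comap (adelicVal F E c 3 ((StdForm.antidiagonal 3).over E)) : Subgroup (quasiSplit F E c 3).Adelic), f ((k : (quasiSplit F E c 3).Adelic)⁻¹ *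
        (((((heisElt hc x (0 : traceZeroAdele F E c) : unipotentInBorel F E c 3) : borelAdelic F E c 3) : (quasiSplit F E c 3).Adelic))⁻¹ *
          ((γ₀ : (quasiSplit F E c 3).Adelic) * (((heisElt hc 0 (traceZeroLine F E c hcδ hδ s) : unipotentInBorel F E c 3) : borelAdelic F E c 3) : (quasiSplit F E c 3).Adelic)) *
          (((heisElt hc x (0 : traceZeroAdele F E c) : unipotentInBorel F E c 3) : borelAdelic F E c 3) : (quasiSplit F E c 3).Adelic)) * (k : (quasiSplit F E c 3).Adelic)) ∂μK) ∂μX) 0) +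
              ((∫ x in {x | 1 ≤ (IdeleClassGroup.ideleNorm F x : ℝ)} ∩ 𝓕F,
                  ideleSum F (fun s : AdeleRing (𝓞 F) F =>
      ∫ x : AdeleRing (𝓞 E) E, (∫ k : ↥((standardMaximalCompactGL 3 E).comap (adelicVal F E c 3 ((StdForm.antidiagonal 3).over E)) : Subgroup (quasiSplit F E c 3).Adelic), f ((k : (quasiSplit F E c 3).Adelic)⁻¹ *
        (((((heisElt hc x (0 : traceZeroAdele F E c) : unipotentInBorel F E c 3) : borelAdelic F E c 3) : (quasiSplit F E c 3).Adelic))⁻¹ *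
          ((γ₀ : (quasiSplit F E c 3).Adelic) * (((heisElt hc 0 (traceZeroLine F E c hcδ hδ s) : unipotentInBorel F E c 3) : borelAdelic F E c 3) : (quasiSplit F E c 3).Adelic)) *
          (((heisElt hc x (0 : traceZeroAdele F E c) : unipotentInBorel F E c 3) : borelAdelic F E c 3) : (quasiSplit F E c 3).Adelic)) * (k : (quasiSplit F E c 3).Adelic)) ∂μK) ∂μX) x * ((IdeleClassGroup.ideleNorm F x : ℝ) : ℂ) ∂νF) +
                ((μA (adeleFundamentalDomain F)).toReal⁻¹ : ℂ) *
                  (∫ x in {x | 1 ≤ (IdeleClassGroup.ideleNorm F x : ℝ)} ∩ 𝓕F,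
                    ideleSum F (adeleFourier F μA (fun s : AdeleRing (𝓞 F) F =>
      ∫ x : AdeleRing (𝓞 E) E, (∫ k : ↥((standardMaximalCompactGL 3 E).comap (adelicVal F E c 3 ((StdForm.antidiagonal 3).over E)) : Subgroup (quasiSplit F E c 3).Adelic), f ((k : (quasiSplit F E c 3).Adelic)⁻¹ *
        (((((heisElt hc x (0 : traceZeroAdele F E c) : unipotentInBorel F E c 3) : borelAdelic F E c 3) : (quasiSplit F E c 3).Adelic))⁻¹ *
          ((γ₀ : (quasiSplit F E c 3).Adelic) * (((heisElt hc 0 (traceZeroLine F E c hcδ hδ s) : unipotentInBorel F E c 3) : borelAdelic F E c 3) : (quasiSplit F E c 3).Adelic)) *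
          (((heisElt hc x (0 : traceZeroAdele F E c) : unipotentInBorel F E c 3) : borelAdelic F E c 3) : (quasiSplit F E c 3).Adelic)) * (k : (quasiSplit F E c 3).Adelic)) ∂μK) ∂μX)) x ∂νF) -
                ((idelicCovolume F νF).toReal : ℂ) * (fun s : AdeleRing (𝓞 F) F =>
      ∫ x : AdeleRing (𝓞 E) E, (∫ k : ↥((standardMaximalCompactGL 3 E).comap (adelicVal F E c 3 ((StdForm.antidiagonal 3).over E)) : Subgroup (quasiSplit F E c 3).Adelic), f ((k : (quasiSplit F E c 3).Adelic)⁻¹ *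
        (((((heisElt hc x (0 : traceZeroAdele F E c) : unipotentInBorel F E c 3) : borelAdelic F E c 3) : (quasiSplit F E c 3).Adelic))⁻¹ *
          ((γ₀ : (quasiSplit F E c 3).Adelic) * (((heisElt hc 0 (traceZeroLine F E c hcδ hδ s) : unipotentInBorel F E c 3) : borelAdelic F E c 3) : (quasiSplit F E c 3).Adelic)) *
          (((heisElt hc x (0 : traceZeroAdele F E c) : unipotentInBorel F E c 3) : borelAdelic F E c 3) : (quasiSplit F E c 3).Adelic)) * (k : (quasiSplit F E c 3).Adelic)) ∂μK) ∂μX) 0)) +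
            (1 / 2 : ℂ) * ((∫ x in {x | 1 ≤ (IdeleClassGroup.ideleNorm F x : ℝ)} ∩ 𝓕F,
                ideleSum F (fun s : AdeleRing (𝓞 F) F =>
      ∫ x : AdeleRing (𝓞 E) E, (∫ k : ↥((standardMaximalCompactGL 3 E).comap (adelicVal F E c 3 ((StdForm.antidiagonal 3).over E)) : Subgroup (quasiSplit F E c 3).Adelic), f ((k : (quasiSplit F E c 3).Adelic)⁻¹ *
        (((((heisElt hc x (0 : traceZeroAdele F E c) : unipotentInBorel F E c 3) : borelAdelic F E c 3) : (quasiSplit F E c 3).Adelic))⁻¹ *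
          ((γ₀ : (quasiSplit F E c 3).Adelic) * (((heisElt hc 0 (traceZeroLine F E c hcδ hδ s) : unipotentInBorel F E c 3) : borelAdelic F E c 3) : (quasiSplit F E c 3).Adelic)) *
          (((heisElt hc x (0 : traceZeroAdele F E c) : unipotentInBorel F E c 3) : borelAdelic F E c 3) : (quasiSplit F E c 3).Adelic)) * (k : (quasiSplit F E c 3).Adelic)) ∂μK) ∂μX) x * (-1 : ℂ) ^ (GaloisRepresentations.quadraticArtinIndicator F ((θ₀ : 𝓞 F) : F) x).val *
                  ((IdeleClassGroup.ideleNorm F x : ℝ) : ℂ) ∂νF) +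
              ((μA (adeleFundamentalDomain F)).toReal⁻¹ : ℂ) *
                ∫ x in {x | 1 ≤ (IdeleClassGroup.ideleNorm F x : ℝ)} ∩ 𝓕F,
                  ideleSum F (adeleFourier F μA (fun s : AdeleRing (𝓞 F) F =>
      ∫ x : AdeleRing (𝓞 E) E, (∫ k : ↥((standardMaximalCompactGL 3 E).comap (adelicVal F E c 3 ((StdForm.antidiagonal 3).over E)) : Subgroup (quasiSplit F E c 3).Adelic), f ((k : (quasiSplit F E c 3).Adelic)⁻¹ *
        (((((heisElt hc x (0 : traceZeroAdele F E c) : unipotentInBorel F E c 3) : borelAdelic F E c 3) : (quasiSplit F E c 3).Adelic))⁻¹ *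
          ((γ₀ : (quasiSplit F E c 3).Adelic) * (((heisElt hc 0 (traceZeroLine F E c hcδ hδ s) : unipotentInBorel F E c 3) : borelAdelic F E c 3) : (quasiSplit F E c 3).Adelic)) *
          (((heisElt hc x (0 : traceZeroAdele F E c) : unipotentInBorel F E c 3) : borelAdelic F E c 3) : (quasiSplit F E c 3).Adelic)) * (k : (quasiSplit F E c 3).Adelic)) ∂μK) ∂μX)) x *
                    (-1 : ℂ) ^ (GaloisRepresentations.quadraticArtinIndicator F ((θ₀ : 𝓞 F) : F) x⁻¹).val ∂νF))) := by
  classical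
  -- ### structure
  haveI : T2Space (quasiSplit F E c 3).Adelic := inferInstanceAs (T2Space (adelic F E c 3 ((StdForm.antidiagonal 3).over E)))
  haveI : SecondCountableTopology (quasiSplit F E c 3).Adelic :=
    inferInstanceAs (SecondCountableTopology (adelic F E c 3 ((StdForm.antidiagonal 3).over E)))
  haveI : LocallyCompactSpace (quasiSplit F E c 3).Adelic := inferInstanceAs (LocallyCompactSpace (adelic F E c 3 ((StdForm.antidiagonal 3).over E)))
  haveI := t2Space_adeleRing_of_numberField E
  haveI := secondCountableTopology_adeleRing E
  haveI := secondCountableTopology_adeleRing F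
  haveI := locallyCompactSpace_traceZeroAdele (F := F) (E := E) (c := c)
  haveI : SecondCountableTopology (traceZeroAdele F E c) := TopologicalSpace.Subtype.secondCountableTopology _
  haveI : BorelSpace (traceZeroAdele F E c) := Subtype.borelSpace _
  haveI : BorelSpace (borelAdelic F E c 3) := Subtype.borelSpace _
  haveI : BorelSpace (unipotentInBorel F E c 3) := Subtype.borelSpace _
  haveI : BorelSpace (torusInBorel F E c 3) := Subtype.borelSpace _
  haveI hμY : (μA.map (traceZeroLine F E c hcδ hδ)).IsAddHaarMeasure := (traceZeroLine F E c hcδ hδ).isAddHaarMeasure_map μA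
  haveI : (μA.map (traceZeroLine F E c hcδ hδ)).Regular := Regular.map (traceZeroLine F E c hcδ hδ).toHomeomorph
  have hKc : IsCompact (((standardMaximalCompactGL 3 E).comap (adelicVal F E c 3 ((StdForm.antidiagonal 3).over E)) : Subgroup (quasiSplit F E c 3).Adelic) : Set (quasiSplit F E c 3).Adelic) := isCompact_comap_adelicVal_standardMaximalCompactGL
  haveI : CompactSpace ↥((standardMaximalCompactGL 3 E).comap (adelicVal F E c 3 ((StdForm.antidiagonal 3).over E)) : Subgroup (quasiSplit F E c 3).Adelic) := isCompact_iff_compactSpace.1 hKc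
  haveI : IsFiniteMeasure μK := CompactSpace.isFiniteMeasure
  have hH : ∀ (z : (quasiSplit F E c 3).Adelic) (k : ↥((standardMaximalCompactGL 3 E).comap (adelicVal F E c 3 ((StdForm.antidiagonal 3).over E)) : Subgroup (quasiSplit F E c 3).Adelic)), borelHeight (z * (k : (quasiSplit F E c 3).Adelic)) = borelHeight z := fun z k =>
    borelHeight_mul_of_mem_comap_standardMaximalCompactGL k.2 z
  have h2 : Module.finrank F E = 2 := Algebra.IsQuadraticExtension.finrank_eq_two F E
  -- ### the three constants, BEFORE the data
  haveI hμN : (heisHaar hc μX (μA.map (traceZeroLine F E c hcδ hδ))).IsHaarMeasure := isHaarMeasure_heisHaar hc μX (μA.map (traceZeroLine F E c hcδ hδ))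
  obtain ⟨hσT, hσN, C₂, hC₂0, hC₂t, hform⟩ := sigmaFinite_and_exists_coord μB μT (heisHaar hc μX (μA.map (traceZeroLine F E c hcδ hδ)))
  haveI := hσT
  haveI := hσN
  have hH₁ : 0 < ((borelHeight (1 : (quasiSplit F E c 3).Adelic) : ℝ≥0) : ℝ) := by exact_mod_cast borelHeight_pos (1 : (quasiSplit F E c 3).Adelic)
  obtain ⟨C₃, hC₃0, hC₃t, hlin⟩ := exists_pushConst_forall_singularTorusStage_eq_linear hc hc1 hcδ hδ θ₀ hθ hd hsq μT μA νF
  obtain ⟨C₁, hC₁, hL0, -, -⟩ := exists_weight_iwasawa_kAverage_of_le (arithmeticBorel F E c 3) le_rfl νG μB μK hBK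
  have hC₂pos : 0 < C₂.toReal := ENNReal.toReal_pos hC₂0 hC₂t
  have hC₃pos : 0 < C₃.toReal := ENNReal.toReal_pos hC₃0 hC₃t
  refine ⟨(C₁ : ℝ) * C₂.toReal * C₃.toReal, by positivity, ?_⟩
  intro a b hab g₀ γ₀ hg₀ hγ₀ f hf β hβ wT hwT 𝓕F h𝓕 T hT
  have hT' : 0 < T := by exact_mod_cast hT
  -- `f^K`, `f♭`
  have hfKc : Continuous fun z : (quasiSplit F E c 3).Adelic => (∫ k : ↥((standardMaximalCompactGL 3 E).comap (adelicVal F E c 3 ((StdForm.antidiagonal 3).over E)) : Subgroup (quasiSplit F E c 3).Adelic), f ((k : (quasiSplit F E c 3).Adelic)⁻¹ * (z) * (k : (quasiSplit F E c 3).Adelic)) ∂μK) := continuous_kConjAverage hKc μK hf.continuous'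
  have hfKs : HasCompactSupport fun z : (quasiSplit F E c 3).Adelic => (∫ k : ↥((standardMaximalCompactGL 3 E).comap (adelicVal F E c 3 ((StdForm.antidiagonal 3).over E)) : Subgroup (quasiSplit F E c 3).Adelic), f ((k : (quasiSplit F E c 3).Adelic)⁻¹ * (z) * (k : (quasiSplit F E c 3).Adelic)) ∂μK) := hasCompactSupport_kConjAverage hKc μK hf.hasCompactSupport'
  have hfS : (fun s : AdeleRing (𝓞 F) F =>
      ∫ x : AdeleRing (𝓞 E) E, (∫ k : ↥((standardMaximalCompactGL 3 E).comap (adelicVal F E c 3 ((StdForm.antidiagonal 3).over E)) : Subgroup (quasiSplit F E c 3).Adelic), f ((k : (quasiSplit F E c 3).Adelic)⁻¹ *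
        (((((heisElt hc x (0 : traceZeroAdele F E c) : unipotentInBorel F E c 3) : borelAdelic F E c 3) : (quasiSplit F E c 3).Adelic))⁻¹ *
          ((γ₀ : (quasiSplit F E c 3).Adelic) * (((heisElt hc 0 (traceZeroLine F E c hcδ hδ s) : unipotentInBorel F E c 3) : borelAdelic F E c 3) : (quasiSplit F E c 3).Adelic)) *
          (((heisElt hc x (0 : traceZeroAdele F E c) : unipotentInBorel F E c 3) : borelAdelic F E c 3) : (quasiSplit F E c 3).Adelic)) * (k : (quasiSplit F E c 3).Adelic)) ∂μK) ∂μX) ∈ schwartzBruhatAdele F :=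
    singularLine_kAverage_mem_schwartzBruhatAdele hc hcδ hδ hab hg₀ hγ₀ μX hKc μK hf
  -- ### (F1) at `Λ = B_{γ₀}(F)`: its constant IS `C₁` (both satisfy (L0))
  obtain ⟨C₁', hC₁', hL0', -, hBoch⟩ := exists_weight_iwasawa_kAverage_of_le
    (arithmeticBorel F E c 3 ⊓ Subgroup.centralizer ({γ₀} : Set (quasiSplit F E c 3).arithmeticSubgroup)) inf_le_left νG μB μK hBK
  have hCC : C₁' = C₁ := by
    obtain ⟨K₀⟩ := (inferInstance : Nonempty (TopologicalSpace.PositiveCompacts (quasiSplit F E c 3).Adelic))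
    have hKm : MeasurableSet (K₀ : Set (quasiSplit F E c 3).Adelic) := K₀.isCompact.measurableSet
    have hΨm : Measurable ((K₀ : Set (quasiSplit F E c 3).Adelic).indicator (1 : (quasiSplit F E c 3).Adelic → ℝ≥0∞)) := measurable_one.indicator hKm
    have h1 := hL0 _ hΨm
    have h2 := hL0' _ hΨm
    rw [lintegral_indicator_one hKm] at h1 h2
    have hpos : νG (K₀ : Set (quasiSplit F E c 3).Adelic) ≠ 0 := (measure_pos_of_nonempty_interior νG K₀.interior_nonempty).ne'
    have htop : νG (K₀ : Set (quasiSplit F E c 3).Adelic) ≠ ∞ := K₀.isCompact.measure_lt_top.ne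
    set I := ∫⁻ b, ∫⁻ k, (K₀ : Set (quasiSplit F E c 3).Adelic).indicator (1 : (quasiSplit F E c 3).Adelic → ℝ≥0∞) ((b : (quasiSplit F E c 3).Adelic) * ((k : ↥((standardMaximalCompactGL 3 E).comap (adelicVal F E c 3 ((StdForm.antidiagonal 3).over E)) : Subgroup (quasiSplit F E c 3).Adelic)) : (quasiSplit F E c 3).Adelic)) ∂μK ∂μB with hI
    have hI0 : I ≠ 0 := by
      intro h0; apply hpos; rw [h1, h0, mul_zero]
    have hIt : I ≠ ∞ := by
      intro ht; apply htop; rw [h1, ht, ENNReal.mul_top (by exact_mod_cast hC₁.ne')]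
    have h12 : (C₁' : ℝ≥0∞) * I = (C₁ : ℝ≥0∞) * I := by rw [← h2, h1]
    exact_mod_cast (ENNReal.mul_left_inj hI0 hIt).1 h12
  subst hCC
  have hw := isCoveringWeight_singularBorelLattice_indicator_mul hc hab hg₀ hγ₀ hwT
  -- ### (c3)(c4) in normal form, per class
  set R : ℝ≥0 → torusInBorel F E c 3 → ℂ := fun T t => ((ideleSum F (fun s : AdeleRing (𝓞 F) F =>
      ∫ x : AdeleRing (𝓞 E) E, (∫ k : ↥((standardMaximalCompactGL 3 E).comap (adelicVal F E c 3 ((StdForm.antidiagonal 3).over E)) : Subgroup (quasiSplit F E c 3).Adelic), f ((k : (quasiSplit F E c 3).Adelic)⁻¹ *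
        (((((heisElt hc x (0 : traceZeroAdele F E c) : unipotentInBorel F E c 3) : borelAdelic F E c 3) : (quasiSplit F E c 3).Adelic))⁻¹ *
          ((γ₀ : (quasiSplit F E c 3).Adelic) * (((heisElt hc 0 (traceZeroLine F E c hcδ hδ s) : unipotentInBorel F E c 3) : borelAdelic F E c 3) : (quasiSplit F E c 3).Adelic)) *
          (((heisElt hc x (0 : traceZeroAdele F E c) : unipotentInBorel F E c 3) : borelAdelic F E c 3) : (quasiSplit F E c 3).Adelic)) * (k : (quasiSplit F E c 3).Adelic)) ∂μK) ∂μX) (AdeleRing.ideleRelNorm F E (diagUnit (t : borelAdelic F E c 3).2 0))⁻¹ -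
              ((IdeleClassGroup.ideleNorm F (AdeleRing.ideleRelNorm F E (diagUnit (t : borelAdelic F E c 3).2 0))⁻¹ : ℝ) : ℂ)⁻¹ *
                {y : GaloisRepresentations.ideleGroup F |
                    (IdeleClassGroup.ideleNorm F y : ℝ) < ((T : ℝ) / ((borelHeight (1 : (quasiSplit F E c 3).Adelic) : ℝ≥0) : ℝ))⁻¹}.indicator
                  (fun _ => ((μA (adeleFundamentalDomain F)).toReal⁻¹ : ℂ) * adeleFourier F μA (fun s : AdeleRing (𝓞 F) F =>
      ∫ x : AdeleRing (𝓞 E) E, (∫ k : ↥((standardMaximalCompactGL 3 E).comap (adelicVal F E c 3 ((StdForm.antidiagonal 3).over E)) : Subgroup (quasiSplit F E c 3).Adelic), f ((k : (quasiSplit F E c 3).Adelic)⁻¹ *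
        (((((heisElt hc x (0 : traceZeroAdele F E c) : unipotentInBorel F E c 3) : borelAdelic F E c 3) : (quasiSplit F E c 3).Adelic))⁻¹ *
          ((γ₀ : (quasiSplit F E c 3).Adelic) * (((heisElt hc 0 (traceZeroLine F E c hcδ hδ s) : unipotentInBorel F E c 3) : borelAdelic F E c 3) : (quasiSplit F E c 3).Adelic)) *
          (((heisElt hc x (0 : traceZeroAdele F E c) : unipotentInBorel F E c 3) : borelAdelic F E c 3) : (quasiSplit F E c 3).Adelic)) * (k : (quasiSplit F E c 3).Adelic)) ∂μK) ∂μX) 0)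
                  (AdeleRing.ideleRelNorm F E (diagUnit (t : borelAdelic F E c 3).2 0))⁻¹) *
            ((IdeleClassGroup.ideleNorm F (AdeleRing.ideleRelNorm F E (diagUnit (t : borelAdelic F E c 3).2 0))⁻¹ : ℝ) : ℂ)) with hR
  set Θ : ℝ≥0 → torusInBorel F E c 3 → ℂ := fun T t =>
    (((torusRootModulus E 3 (diagUnit (t : borelAdelic F E c 3).2) : ℝ≥0) : ℝ)) • ((((μA.map (traceZeroLine F E c hcδ hδ)).real (traceZeroFundamentalDomain F E c) : ℝ) : ℂ) * R T t) with hΘ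
  have hΘnf : ∀ (T : ℝ≥0) (t : torusInBorel F E c 3),
      ((torusRootModulus E 3 (diagUnit (t : borelAdelic F E c 3).2) : ℝ≥0) : ℝ)⁻¹ • Θ T t =
        (((μA.map (traceZeroLine F E c hcδ hδ)).real (traceZeroFundamentalDomain F E c) : ℝ) : ℂ) * ((ideleSum F (fun s : AdeleRing (𝓞 F) F =>
      ∫ x : AdeleRing (𝓞 E) E, (∫ k : ↥((standardMaximalCompactGL 3 E).comap (adelicVal F E c 3 ((StdForm.antidiagonal 3).over E)) : Subgroup (quasiSplit F E c 3).Adelic), f ((k : (quasiSplit F E c 3).Adelic)⁻¹ *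
        (((((heisElt hc x (0 : traceZeroAdele F E c) : unipotentInBorel F E c 3) : borelAdelic F E c 3) : (quasiSplit F E c 3).Adelic))⁻¹ *
          ((γ₀ : (quasiSplit F E c 3).Adelic) * (((heisElt hc 0 (traceZeroLine F E c hcδ hδ s) : unipotentInBorel F E c 3) : borelAdelic F E c 3) : (quasiSplit F E c 3).Adelic)) *
          (((heisElt hc x (0 : traceZeroAdele F E c) : unipotentInBorel F E c 3) : borelAdelic F E c 3) : (quasiSplit F E c 3).Adelic)) * (k : (quasiSplit F E c 3).Adelic)) ∂μK) ∂μX) (AdeleRing.ideleRelNorm F E (diagUnit (t : borelAdelic F E c 3).2 0))⁻¹ -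
              ((IdeleClassGroup.ideleNorm F (AdeleRing.ideleRelNorm F E (diagUnit (t : borelAdelic F E c 3).2 0))⁻¹ : ℝ) : ℂ)⁻¹ *
                {y : GaloisRepresentations.ideleGroup F |
                    (IdeleClassGroup.ideleNorm F y : ℝ) < ((T : ℝ) / ((borelHeight (1 : (quasiSplit F E c 3).Adelic) : ℝ≥0) : ℝ))⁻¹}.indicator
                  (fun _ => ((μA (adeleFundamentalDomain F)).toReal⁻¹ : ℂ) * adeleFourier F μA (fun s : AdeleRing (𝓞 F) F =>
      ∫ x : AdeleRing (𝓞 E) E, (∫ k : ↥((standardMaximalCompactGL 3 E).comap (adelicVal F E c 3 ((StdForm.antidiagonal 3).over E)) : Subgroup (quasiSplit F E c 3).Adelic), f ((k : (quasiSplit F E c 3).Adelic)⁻¹ *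
        (((((heisElt hc x (0 : traceZeroAdele F E c) : unipotentInBorel F E c 3) : borelAdelic F E c 3) : (quasiSplit F E c 3).Adelic))⁻¹ *
          ((γ₀ : (quasiSplit F E c 3).Adelic) * (((heisElt hc 0 (traceZeroLine F E c hcδ hδ s) : unipotentInBorel F E c 3) : borelAdelic F E c 3) : (quasiSplit F E c 3).Adelic)) *
          (((heisElt hc x (0 : traceZeroAdele F E c) : unipotentInBorel F E c 3) : borelAdelic F E c 3) : (quasiSplit F E c 3).Adelic)) * (k : (quasiSplit F E c 3).Adelic)) ∂μK) ∂μX) 0)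
                  (AdeleRing.ideleRelNorm F E (diagUnit (t : borelAdelic F E c 3).2 0))⁻¹) *
            ((IdeleClassGroup.ideleNorm F (AdeleRing.ideleRelNorm F E (diagUnit (t : borelAdelic F E c 3).2 0))⁻¹ : ℝ) : ℂ)) := fun T t => by
    simp only [hΘ, hR]
    rw [inv_smul_smul₀ (by exact_mod_cast (torusRootModulus_pos E 3 _).ne')]
  have hlinT := hlin h𝓕 hwT hfS hH₁ ((μA.map (traceZeroLine F E c hcδ hδ)).real (traceZeroFundamentalDomain F E c)) hΘnf T hT
  -- ### Step A — (F1) (BΛ) applied to `ψ := b_T[f]`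
  have hψm : Measurable fun g : (quasiSplit F E c 3).Adelic => ((∑' n : {n : ↥((adelicUnipotent F E c 3).subgroupOf (quasiSplit F E c 3).arithmeticSubgroup ⊓
            Subgroup.centralizer ({γ₀} : Set (quasiSplit F E c 3).arithmeticSubgroup)) // n ≠ 1},
          f ((g)⁻¹ * (((n.1 : (quasiSplit F E c 3).arithmeticSubgroup) * γ₀ : (quasiSplit F E c 3).arithmeticSubgroup) : (quasiSplit F E c 3).Adelic) * (g))) -
        Set.indicator {z : (quasiSplit F E c 3).Adelic | T < borelHeight z}
          (fun z => ((μA.map (traceZeroLine F E c hcδ hδ)) (traceZeroFundamentalDomain F E c)).toReal⁻¹ • ∫ w : traceZeroAdele F E c,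
            f (z⁻¹ * ((γ₀ : (quasiSplit F E c 3).Adelic) * (((heisElt hc 0 w : unipotentInBorel F E c 3) : borelAdelic F E c 3) : (quasiSplit F E c 3).Adelic)) * z) ∂(μA.map (traceZeroLine F E c hcδ hδ))) (g)) := measurable_singularBracket hc γ₀ (μA.map (traceZeroLine F E c hcδ hδ)) T hf.continuous'
  have hψinv : ∀ b ∈ arithmeticBorel F E c 3 ⊓ Subgroup.centralizer ({γ₀} : Set (quasiSplit F E c 3).arithmeticSubgroup), ∀ y : (quasiSplit F E c 3).Adelic,
      (fun g : (quasiSplit F E c 3).Adelic => ((∑' n : {n : ↥((adelicUnipotent F E c 3).subgroupOf (quasiSplit F E c 3).arithmeticSubgroup ⊓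
            Subgroup.centralizer ({γ₀} : Set (quasiSplit F E c 3).arithmeticSubgroup)) // n ≠ 1},
          f ((g)⁻¹ * (((n.1 : (quasiSplit F E c 3).arithmeticSubgroup) * γ₀ : (quasiSplit F E c 3).arithmeticSubgroup) : (quasiSplit F E c 3).Adelic) * (g))) -
        Set.indicator {z : (quasiSplit F E c 3).Adelic | T < borelHeight z}
          (fun z => ((μA.map (traceZeroLine F E c hcδ hδ)) (traceZeroFundamentalDomain F E c)).toReal⁻¹ • ∫ w : traceZeroAdele F E c,
            f (z⁻¹ * ((γ₀ : (quasiSplit F E c 3).Adelic) * (((heisElt hc 0 w : unipotentInBorel F E c 3) : borelAdelic F E c 3) : (quasiSplit F E c 3).Adelic)) * z) ∂(μA.map (traceZeroLine F E c hcδ hδ))) (g))) ((b : (quasiSplit F E c 3).Adelic) * y) = (fun g : (quasiSplit F E c 3).Adelic => ((∑' n : {n : ↥((adelicUnipotent F E c 3).subgroupOf (quasiSplit F E c 3).arithmeticSubgroup ⊓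
            Subgroup.centralizer ({γ₀} : Set (quasiSplit F E c 3).arithmeticSubgroup)) // n ≠ 1},
          f ((g)⁻¹ * (((n.1 : (quasiSplit F E c 3).arithmeticSubgroup) * γ₀ : (quasiSplit F E c 3).arithmeticSubgroup) : (quasiSplit F E c 3).Adelic) * (g))) -
        Set.indicator {z : (quasiSplit F E c 3).Adelic | T < borelHeight z}
          (fun z => ((μA.map (traceZeroLine F E c hcδ hδ)) (traceZeroFundamentalDomain F E c)).toReal⁻¹ • ∫ w : traceZeroAdele F E c,
            f (z⁻¹ * ((γ₀ : (quasiSplit F E c 3).Adelic) * (((heisElt hc 0 w : unipotentInBorel F E c 3) : borelAdelic F E c 3) : (quasiSplit F E c 3).Adelic)) * z) ∂(μA.map (traceZeroLine F E c hcδ hδ))) (g))) y := fun b hb y =>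
    singularBracket_borelCentralizer_mul hc hc1 γ₀ (μA.map (traceZeroLine F E c hcδ hδ)) T f hb y
  have hfin := lintegral_weight_mul_enorm_singularBracket_lt_top hc hc1 h2 hab hg₀ hγ₀ hf hBK νG μB μT μK μX (μA.map (traceZeroLine F E c hcδ hδ)) hβ hT'
  obtain ⟨hintB, hA⟩ := hBoch β hβ _ hw (fun g : (quasiSplit F E c 3).Adelic => ((∑' n : {n : ↥((adelicUnipotent F E c 3).subgroupOf (quasiSplit F E c 3).arithmeticSubgroup ⊓
            Subgroup.centralizer ({γ₀} : Set (quasiSplit F E c 3).arithmeticSubgroup)) // n ≠ 1},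
          f ((g)⁻¹ * (((n.1 : (quasiSplit F E c 3).arithmeticSubgroup) * γ₀ : (quasiSplit F E c 3).arithmeticSubgroup) : (quasiSplit F E c 3).Adelic) * (g))) -
        Set.indicator {z : (quasiSplit F E c 3).Adelic | T < borelHeight z}
          (fun z => ((μA.map (traceZeroLine F E c hcδ hδ)) (traceZeroFundamentalDomain F E c)).toReal⁻¹ • ∫ w : traceZeroAdele F E c,
            f (z⁻¹ * ((γ₀ : (quasiSplit F E c 3).Adelic) * (((heisElt hc 0 w : unipotentInBorel F E c 3) : borelAdelic F E c 3) : (quasiSplit F E c 3).Adelic)) * z) ∂(μA.map (traceZeroLine F E c hcδ hδ))) (g))) hψm hψinv hfin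
  -- ### Step B — (c5)(10)
  have h10 : ∀ b : borelAdelic F E c 3,
      (∫ k : ↥((standardMaximalCompactGL 3 E).comap (adelicVal F E c 3 ((StdForm.antidiagonal 3).over E)) : Subgroup (quasiSplit F E c 3).Adelic), (fun g : (quasiSplit F E c 3).Adelic => ((∑' n : {n : ↥((adelicUnipotent F E c 3).subgroupOf (quasiSplit F E c 3).arithmeticSubgroup ⊓
            Subgroup.centralizer ({γ₀} : Set (quasiSplit F E c 3).arithmeticSubgroup)) // n ≠ 1},
          f ((g)⁻¹ * (((n.1 : (quasiSplit F E c 3).arithmeticSubgroup) * γ₀ : (quasiSplit F E c 3).arithmeticSubgroup) : (quasiSplit F E c 3).Adelic) * (g))) -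
        Set.indicator {z : (quasiSplit F E c 3).Adelic | T < borelHeight z}
          (fun z => ((μA.map (traceZeroLine F E c hcδ hδ)) (traceZeroFundamentalDomain F E c)).toReal⁻¹ • ∫ w : traceZeroAdele F E c,
            f (z⁻¹ * ((γ₀ : (quasiSplit F E c 3).Adelic) * (((heisElt hc 0 w : unipotentInBorel F E c 3) : borelAdelic F E c 3) : (quasiSplit F E c 3).Adelic)) * z) ∂(μA.map (traceZeroLine F E c hcδ hδ))) (g))) ((b : (quasiSplit F E c 3).Adelic) * (k : (quasiSplit F E c 3).Adelic)) ∂μK) = ((∑' n : {n : ↥((adelicUnipotent F E c 3).subgroupOf (quasiSplit F E c 3).arithmeticSubgroup ⊓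
            Subgroup.centralizer ({γ₀} : Set (quasiSplit F E c 3).arithmeticSubgroup)) // n ≠ 1},
          (fun z : (quasiSplit F E c 3).Adelic => (∫ k : ↥((standardMaximalCompactGL 3 E).comap (adelicVal F E c 3 ((StdForm.antidiagonal 3).over E)) : Subgroup (quasiSplit F E c 3).Adelic), f ((k : (quasiSplit F E c 3).Adelic)⁻¹ * (z) * (k : (quasiSplit F E c 3).Adelic)) ∂μK)) (((b : (quasiSplit F E c 3).Adelic))⁻¹ * (((n.1 : (quasiSplit F E c 3).arithmeticSubgroup) * γ₀ : (quasiSplit F E c 3).arithmeticSubgroup) : (quasiSplit F E c 3).Adelic) * ((b : (quasiSplit F E c 3).Adelic)))) -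
        Set.indicator {z : (quasiSplit F E c 3).Adelic | T < borelHeight z}
          (fun z => ((μA.map (traceZeroLine F E c hcδ hδ)) (traceZeroFundamentalDomain F E c)).toReal⁻¹ • ∫ w : traceZeroAdele F E c,
            (fun z : (quasiSplit F E c 3).Adelic => (∫ k : ↥((standardMaximalCompactGL 3 E).comap (adelicVal F E c 3 ((StdForm.antidiagonal 3).over E)) : Subgroup (quasiSplit F E c 3).Adelic), f ((k : (quasiSplit F E c 3).Adelic)⁻¹ * (z) * (k : (quasiSplit F E c 3).Adelic)) ∂μK)) (z⁻¹ * ((γ₀ : (quasiSplit F E c 3).Adelic) * (((heisElt hc 0 w : unipotentInBorel F E c 3) : borelAdelic F E c 3) : (quasiSplit F E c 3).Adelic)) * z) ∂(μA.map (traceZeroLine F E c hcδ hδ))) ((b : (quasiSplit F E c 3).Adelic))) := fun b =>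
    integral_singularBracket_mul_eq_singularBracket_kAverage hc γ₀ hKc μK hH (μA.map (traceZeroLine F E c hcδ hδ)) hf.hasCompactSupport' hf.continuous' T (b : (quasiSplit F E c 3).Adelic)
  -- ### Step C — (G-c)
  have hΘBm : Measurable fun b : borelAdelic F E c 3 => ((∑' n : {n : ↥((adelicUnipotent F E c 3).subgroupOf (quasiSplit F E c 3).arithmeticSubgroup ⊓
            Subgroup.centralizer ({γ₀} : Set (quasiSplit F E c 3).arithmeticSubgroup)) // n ≠ 1},
          (fun z : (quasiSplit F E c 3).Adelic => (∫ k : ↥((standardMaximalCompactGL 3 E).comap (adelicVal F E c 3 ((StdForm.antidiagonal 3).over E)) : Subgroup (quasiSplit F E c 3).Adelic), f ((k : (quasiSplit F E c 3).Adelic)⁻¹ * (z) * (k : (quasiSplit F E c 3).Adelic)) ∂μK)) (((b : (quasiSplit F E c 3).Adelic))⁻¹ * (((n.1 : (quasiSplit F E c 3).arithmeticSubgroup) * γ₀ : (quasiSplit F E c 3).arithmeticSubgroup) : (quasiSplit F E c 3).Adelic) * ((b : (quasiSplit F E c 3).Adelic)))) -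
        Set.indicator {z : (quasiSplit F E c 3).Adelic | T < borelHeight z}
          (fun z => ((μA.map (traceZeroLine F E c hcδ hδ)) (traceZeroFundamentalDomain F E c)).toReal⁻¹ • ∫ w : traceZeroAdele F E c,
            (fun z : (quasiSplit F E c 3).Adelic => (∫ k : ↥((standardMaximalCompactGL 3 E).comap (adelicVal F E c 3 ((StdForm.antidiagonal 3).over E)) : Subgroup (quasiSplit F E c 3).Adelic), f ((k : (quasiSplit F E c 3).Adelic)⁻¹ * (z) * (k : (quasiSplit F E c 3).Adelic)) ∂μK)) (z⁻¹ * ((γ₀ : (quasiSplit F E c 3).Adelic) * (((heisElt hc 0 w : unipotentInBorel F E c 3) : borelAdelic F E c 3) : (quasiSplit F E c 3).Adelic)) * z) ∂(μA.map (traceZeroLine F E c hcδ hδ))) ((b : (quasiSplit F E c 3).Adelic))) :=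
    (measurable_singularBracket hc γ₀ (μA.map (traceZeroLine F E c hcδ hδ)) T hfKc).comp continuous_subtype_val.measurable
  have hintB' : Integrable (fun b : borelAdelic F E c 3 =>
      ({u : unipotentInBorel F E c 3 | heisY hc u ∈ (traceZeroFundamentalDomain F E c)}.indicator (1 : unipotentInBorel F E c 3 → ℝ≥0∞)
          ⟨b * (torusPart b)⁻¹, mul_torusPart_inv_mem_unipotentInBorel b⟩ *
        wT ⟨torusPart b, torusPart_mem_torusAdelic b⟩).toReal • ((∑' n : {n : ↥((adelicUnipotent F E c 3).subgroupOf (quasiSplit F E c 3).arithmeticSubgroup ⊓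
            Subgroup.centralizer ({γ₀} : Set (quasiSplit F E c 3).arithmeticSubgroup)) // n ≠ 1},
          (fun z : (quasiSplit F E c 3).Adelic => (∫ k : ↥((standardMaximalCompactGL 3 E).comap (adelicVal F E c 3 ((StdForm.antidiagonal 3).over E)) : Subgroup (quasiSplit F E c 3).Adelic), f ((k : (quasiSplit F E c 3).Adelic)⁻¹ * (z) * (k : (quasiSplit F E c 3).Adelic)) ∂μK)) (((b : (quasiSplit F E c 3).Adelic))⁻¹ * (((n.1 : (quasiSplit F E c 3).arithmeticSubgroup) * γ₀ : (quasiSplit F E c 3).arithmeticSubgroup) : (quasiSplit F E c 3).Adelic) * ((b : (quasiSplit F E c 3).Adelic)))) -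
        Set.indicator {z : (quasiSplit F E c 3).Adelic | T < borelHeight z}
          (fun z => ((μA.map (traceZeroLine F E c hcδ hδ)) (traceZeroFundamentalDomain F E c)).toReal⁻¹ • ∫ w : traceZeroAdele F E c,
            (fun z : (quasiSplit F E c 3).Adelic => (∫ k : ↥((standardMaximalCompactGL 3 E).comap (adelicVal F E c 3 ((StdForm.antidiagonal 3).over E)) : Subgroup (quasiSplit F E c 3).Adelic), f ((k : (quasiSplit F E c 3).Adelic)⁻¹ * (z) * (k : (quasiSplit F E c 3).Adelic)) ∂μK)) (z⁻¹ * ((γ₀ : (quasiSplit F E c 3).Adelic) * (((heisElt hc 0 w : unipotentInBorel F E c 3) : borelAdelic F E c 3) : (quasiSplit F E c 3).Adelic)) * z) ∂(μA.map (traceZeroLine F E c hcδ hδ))) ((b : (quasiSplit F E c 3).Adelic)))) μB := by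
    refine hintB.congr (ae_of_all _ fun b => ?_)
    simp only [h10]
  obtain ⟨-, hGc⟩ := integral_indicatorProductWeight_smul_eq_of_coord hc hc1 μB μT (heisHaar hc μX (μA.map (traceZeroLine F E c hcδ hδ))) hC₂0 hC₂t hform
    (measurableSet_centreBox hc) hwT.measurable hΘBm hintB'
  -- ### Step D — per torus point
  have hper : ∀ t : torusInBorel F E c 3,
      (∫ n in {u : unipotentInBorel F E c 3 | heisY hc u ∈ (traceZeroFundamentalDomain F E c)},
        (fun b : borelAdelic F E c 3 => ((∑' n : {n : ↥((adelicUnipotent F E c 3).subgroupOf (quasiSplit F E c 3).arithmeticSubgroup ⊓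
            Subgroup.centralizer ({γ₀} : Set (quasiSplit F E c 3).arithmeticSubgroup)) // n ≠ 1},
          (fun z : (quasiSplit F E c 3).Adelic => (∫ k : ↥((standardMaximalCompactGL 3 E).comap (adelicVal F E c 3 ((StdForm.antidiagonal 3).over E)) : Subgroup (quasiSplit F E c 3).Adelic), f ((k : (quasiSplit F E c 3).Adelic)⁻¹ * (z) * (k : (quasiSplit F E c 3).Adelic)) ∂μK)) (((b : (quasiSplit F E c 3).Adelic))⁻¹ * (((n.1 : (quasiSplit F E c 3).arithmeticSubgroup) * γ₀ : (quasiSplit F E c 3).arithmeticSubgroup) : (quasiSplit F E c 3).Adelic) * ((b : (quasiSplit F E c 3).Adelic)))) -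
        Set.indicator {z : (quasiSplit F E c 3).Adelic | T < borelHeight z}
          (fun z => ((μA.map (traceZeroLine F E c hcδ hδ)) (traceZeroFundamentalDomain F E c)).toReal⁻¹ • ∫ w : traceZeroAdele F E c,
            (fun z : (quasiSplit F E c 3).Adelic => (∫ k : ↥((standardMaximalCompactGL 3 E).comap (adelicVal F E c 3 ((StdForm.antidiagonal 3).over E)) : Subgroup (quasiSplit F E c 3).Adelic), f ((k : (quasiSplit F E c 3).Adelic)⁻¹ * (z) * (k : (quasiSplit F E c 3).Adelic)) ∂μK)) (z⁻¹ * ((γ₀ : (quasiSplit F E c 3).Adelic) * (((heisElt hc 0 w : unipotentInBorel F E c 3) : borelAdelic F E c 3) : (quasiSplit F E c 3).Adelic)) * z) ∂(μA.map (traceZeroLine F E c hcδ hδ))) ((b : (quasiSplit F E c 3).Adelic)))) ((n : borelAdelic F E c 3) * (t : borelAdelic F E c 3)) ∂(heisHaar hc μX (μA.map (traceZeroLine F E c hcδ hδ)))) =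
      Θ T t := fun t => by
    have hδpos : (0 : ℝ) < ((torusRootModulus E 3 (diagUnit (t : borelAdelic F E c 3).2) : ℝ≥0) : ℝ) := by
      exact_mod_cast torusRootModulus_pos E 3 _
    have hC := torusRootModulus_inv_smul_setIntegral_box_singularBracket_mul_torus_eq hc hc1 hab hg₀ hγ₀ μX (μA.map (traceZeroLine F E c hcδ hδ)) t (1 : (quasiSplit F E c 3).Adelic) T
      hfKs hfKc (measurableSet_traceZeroFundamentalDomain (F := F) (E := E) (c := c))
    simp only [mul_one, inv_one, one_mul] at hC
    rw [← centreBox_eq_image_heisHomeomorph] at hC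
    have h8 := singularFibre_eq_tateIntegrand (E := E) (c := c) hc hcδ hδ μA t
      (fun w : traceZeroAdele F E c => ∫ x : AdeleRing (𝓞 E) E, (∫ k : ↥((standardMaximalCompactGL 3 E).comap (adelicVal F E c 3 ((StdForm.antidiagonal 3).over E)) : Subgroup (quasiSplit F E c 3).Adelic), f ((k : (quasiSplit F E c 3).Adelic)⁻¹ * ((((heisElt hc x (0 : traceZeroAdele F E c) : unipotentInBorel F E c 3) : borelAdelic F E c 3) : (quasiSplit F E c 3).Adelic)⁻¹ * ((γ₀ : (quasiSplit F E c 3).Adelic) * (((heisElt hc 0 w : unipotentInBorel F E c 3) : borelAdelic F E c 3) : (quasiSplit F E c 3).Adelic)) * (((heisElt hc x (0 : traceZeroAdele F E c) : unipotentInBorel F E c 3) : borelAdelic F E c 3) : (quasiSplit F E c 3).Adelic)) * (k : (quasiSplit F E c 3).Adelic)) ∂μK) ∂μX) hT' (borelHeight (1 : (quasiSplit F E c 3).Adelic))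
    rw [h8] at hC
    have hC' := congrArg (fun z : ℂ => (((torusRootModulus E 3 (diagUnit (t : borelAdelic F E c 3).2) : ℝ≥0) : ℝ)) • z) hC
    simp only [smul_inv_smul₀ hδpos.ne'] at hC'
    rw [hΘ]
    simp only [hR]
    rw [← hC']
    rfl
  -- ### Step E — assemble
  rw [hA]
  have hB : (∫ b : borelAdelic F E c 3,
      ({u : unipotentInBorel F E c 3 | heisY hc u ∈ (traceZeroFundamentalDomain F E c)}.indicator (1 : unipotentInBorel F E c 3 → ℝ≥0∞)
          ⟨b * (torusPart b)⁻¹, mul_torusPart_inv_mem_unipotentInBorel b⟩ *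
        wT ⟨torusPart b, torusPart_mem_torusAdelic b⟩).toReal •
        (∫ k : ↥((standardMaximalCompactGL 3 E).comap (adelicVal F E c 3 ((StdForm.antidiagonal 3).over E)) : Subgroup (quasiSplit F E c 3).Adelic), (fun g : (quasiSplit F E c 3).Adelic => ((∑' n : {n : ↥((adelicUnipotent F E c 3).subgroupOf (quasiSplit F E c 3).arithmeticSubgroup ⊓
            Subgroup.centralizer ({γ₀} : Set (quasiSplit F E c 3).arithmeticSubgroup)) // n ≠ 1},
          f ((g)⁻¹ * (((n.1 : (quasiSplit F E c 3).arithmeticSubgroup) * γ₀ : (quasiSplit F E c 3).arithmeticSubgroup) : (quasiSplit F E c 3).Adelic) * (g))) -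
        Set.indicator {z : (quasiSplit F E c 3).Adelic | T < borelHeight z}
          (fun z => ((μA.map (traceZeroLine F E c hcδ hδ)) (traceZeroFundamentalDomain F E c)).toReal⁻¹ • ∫ w : traceZeroAdele F E c,
            f (z⁻¹ * ((γ₀ : (quasiSplit F E c 3).Adelic) * (((heisElt hc 0 w : unipotentInBorel F E c 3) : borelAdelic F E c 3) : (quasiSplit F E c 3).Adelic)) * z) ∂(μA.map (traceZeroLine F E c hcδ hδ))) (g))) ((b : (quasiSplit F E c 3).Adelic) * (k : (quasiSplit F E c 3).Adelic)) ∂μK) ∂μB) =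
      ∫ b : borelAdelic F E c 3,
      ({u : unipotentInBorel F E c 3 | heisY hc u ∈ (traceZeroFundamentalDomain F E c)}.indicator (1 : unipotentInBorel F E c 3 → ℝ≥0∞)
          ⟨b * (torusPart b)⁻¹, mul_torusPart_inv_mem_unipotentInBorel b⟩ *
        wT ⟨torusPart b, torusPart_mem_torusAdelic b⟩).toReal • ((∑' n : {n : ↥((adelicUnipotent F E c 3).subgroupOf (quasiSplit F E c 3).arithmeticSubgroup ⊓
            Subgroup.centralizer ({γ₀} : Set (quasiSplit F E c 3).arithmeticSubgroup)) // n ≠ 1},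
          (fun z : (quasiSplit F E c 3).Adelic => (∫ k : ↥((standardMaximalCompactGL 3 E).comap (adelicVal F E c 3 ((StdForm.antidiagonal 3).over E)) : Subgroup (quasiSplit F E c 3).Adelic), f ((k : (quasiSplit F E c 3).Adelic)⁻¹ * (z) * (k : (quasiSplit F E c 3).Adelic)) ∂μK)) (((b : (quasiSplit F E c 3).Adelic))⁻¹ * (((n.1 : (quasiSplit F E c 3).arithmeticSubgroup) * γ₀ : (quasiSplit F E c 3).arithmeticSubgroup) : (quasiSplit F E c 3).Adelic) * ((b : (quasiSplit F E c 3).Adelic)))) -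
        Set.indicator {z : (quasiSplit F E c 3).Adelic | T < borelHeight z}
          (fun z => ((μA.map (traceZeroLine F E c hcδ hδ)) (traceZeroFundamentalDomain F E c)).toReal⁻¹ • ∫ w : traceZeroAdele F E c,
            (fun z : (quasiSplit F E c 3).Adelic => (∫ k : ↥((standardMaximalCompactGL 3 E).comap (adelicVal F E c 3 ((StdForm.antidiagonal 3).over E)) : Subgroup (quasiSplit F E c 3).Adelic), f ((k : (quasiSplit F E c 3).Adelic)⁻¹ * (z) * (k : (quasiSplit F E c 3).Adelic)) ∂μK)) (z⁻¹ * ((γ₀ : (quasiSplit F E c 3).Adelic) * (((heisElt hc 0 w : unipotentInBorel F E c 3) : borelAdelic F E c 3) : (quasiSplit F E c 3).Adelic)) * z) ∂(μA.map (traceZeroLine F E c hcδ hδ))) ((b : (quasiSplit F E c 3).Adelic))) ∂μB :=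
    integral_congr_ae (ae_of_all _ fun b => by simp only [h10])
  rw [hB, hGc]
  have hD : (∫ t : torusInBorel F E c 3,
      ((wT t).toReal * ((torusRootModulus E 3 (diagUnit (t : borelAdelic F E c 3).2) : ℝ≥0) : ℝ)⁻¹) •
        ∫ n in {u : unipotentInBorel F E c 3 | heisY hc u ∈ (traceZeroFundamentalDomain F E c)},
          (fun b : borelAdelic F E c 3 => ((∑' n : {n : ↥((adelicUnipotent F E c 3).subgroupOf (quasiSplit F E c 3).arithmeticSubgroup ⊓
            Subgroup.centralizer ({γ₀} : Set (quasiSplit F E c 3).arithmeticSubgroup)) // n ≠ 1},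
          (fun z : (quasiSplit F E c 3).Adelic => (∫ k : ↥((standardMaximalCompactGL 3 E).comap (adelicVal F E c 3 ((StdForm.antidiagonal 3).over E)) : Subgroup (quasiSplit F E c 3).Adelic), f ((k : (quasiSplit F E c 3).Adelic)⁻¹ * (z) * (k : (quasiSplit F E c 3).Adelic)) ∂μK)) (((b : (quasiSplit F E c 3).Adelic))⁻¹ * (((n.1 : (quasiSplit F E c 3).arithmeticSubgroup) * γ₀ : (quasiSplit F E c 3).arithmeticSubgroup) : (quasiSplit F E c 3).Adelic) * ((b : (quasiSplit F E c 3).Adelic)))) -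
        Set.indicator {z : (quasiSplit F E c 3).Adelic | T < borelHeight z}
          (fun z => ((μA.map (traceZeroLine F E c hcδ hδ)) (traceZeroFundamentalDomain F E c)).toReal⁻¹ • ∫ w : traceZeroAdele F E c,
            (fun z : (quasiSplit F E c 3).Adelic => (∫ k : ↥((standardMaximalCompactGL 3 E).comap (adelicVal F E c 3 ((StdForm.antidiagonal 3).over E)) : Subgroup (quasiSplit F E c 3).Adelic), f ((k : (quasiSplit F E c 3).Adelic)⁻¹ * (z) * (k : (quasiSplit F E c 3).Adelic)) ∂μK)) (z⁻¹ * ((γ₀ : (quasiSplit F E c 3).Adelic) * (((heisElt hc 0 w : unipotentInBorel F E c 3) : borelAdelic F E c 3) : (quasiSplit F E c 3).Adelic)) * z) ∂(μA.map (traceZeroLine F E c hcδ hδ))) ((b : (quasiSplit F E c 3).Adelic)))) ((n : borelAdelic F E c 3) * (t : borelAdelic F E c 3)) ∂(heisHaar hc μX (μA.map (traceZeroLine F E c hcδ hδ))) ∂μT) =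
      ∫ t : torusInBorel F E c 3,
      ((wT t).toReal * ((torusRootModulus E 3 (diagUnit (t : borelAdelic F E c 3).2) : ℝ≥0) : ℝ)⁻¹) • Θ T t ∂μT :=
    integral_congr_ae (ae_of_all _ fun t => by beta_reduce; rw [hper t])
  rw [hD, hlinT]
  push_cast
  ring

end UnitaryGroup

end Literature.NumberTheory.Automorphic
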